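import Literature.NumberTheory.EllipticCurves.OrdinaryReductionFrobeniusHomProofs
import Literature.NumberTheory.EllipticCurves.FrobeniusEndomorphism
import Literature.NumberTheory.EllipticCurves.PointDivisibilityProofs
import Summits.BirchSwinnertonDyer.BirchSwinnertonDyer.Theorems.EisensteinPrimesFullDescentOrdinaryDet
import HarnessLib

/-!
# The kernel of reduction on `E[p²]` at a good ORDINARY place `v ∣ p`: order `p²`, cyclic, inertia
# acts on it through `χ̄_{p²}` and trivially on `E[p²]` modulo it; the decomposition group cannot
# act trivially on the quotient

Cell `bsd-eis`, seat `bsd-line-x1-p1-w4` gen 6 (width seat on crux 2 `GoodLatticeBDPValue`,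
stmt-BirchSwinnertonDyer-19032, line `halves`). ROUTE-FREE helper (`--supports` the crux): brick **F3
«ordinary level 9 at 3»** of the AN-3 Stub B road (w3 g4's memo `AN3-StubB-elementary-road.md` §4: steps
L0 / A2-at-3 / A3-at-3 / A5 of the elementary `E[9]` proof of Theorem T″), stated for an arbitrary number
field `K`, prime `p` and place `v ∣ p` of good ordinary reduction. THEOREMS ONLY (no definition, no named
fact, no `sorry`); nothing here closes a stub or proves a summit statement.

`exists_ordinary_reduction_kernels` — for `W/K` elliptic, `v ∣ p` good ordinary (`p ∤ a_v`) and SOME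
inertia element on which `χ̄_p` is non-trivial (automatic when `e(v|p) < p − 1`, e.g. `K = ℚ`, `p` odd):
with `f : E(K̄) → Ẽ_v(k̄_v)` the tree's reduction map at the good local model
(`exists_goodReductionHom_frobenius`: kernel `Γ_{K_v}`-stable, inertia-invariant, Frobenius-equivariant,
`#(ker f ∩ E[p]) = p`), the subgroups `Λ := ker f ⊓ E[p]` and `K₂ := ker f ⊓ E[p²]` satisfy: `#Λ = p`,
`#K₂ = p²`, `K₂ ⊓ E[p] = Λ`; both stable under the decomposition group `Γ_{K_v} → Γ_K`
(`absGaloisRestrict`); the inertia group `absInertia K_v` acts trivially on `E[p]/Λ` and on `E[p²]/K₂`,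
on `Λ` through `χ̄_p` and on `K₂` through `χ̄_{p²}` (§1 of the `…OrdinaryDet` file); and **if the whole
decomposition group acts trivially on `E[p²]/K₂` then `p² ≤ #Ẽ_v(k_v)`** (the `p²` points
`f(E[p²]) ≅ E[p²]/K₂` are fixed by the `q_v`-Frobenius, hence `k_v`-rational:
`mem_range_toGeomPoints_of_smul_eq`). Serre 1972 §1.11 Prop. 11 and Cor.; Greenberg LNM 1716 §2. The
`ℚ`, `p` odd specialisation (where `p² > 2p + 1 ≥ #Ẽ(𝔽_p)` makes the last clause absurd) is the sequel
`EisensteinPrimesFullDescentOrdinaryNine`.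

References: [SerreInventiones1972] §1.11 Prop. 11, Cor.; [SilvermanAEC2009] VII.2.1, VII.3.1, V.1.1
(proof); [GreenbergLNM1716] §2 pp. 62–63.
-/

set_option linter.dupNamespace false
set_option autoImplicit false

noncomputable section

open scoped Classical NNReal NumberField AddSubgroup
open NumberField IsDedekindDomain

namespace Summit.BirchSwinnertonDyer.BirchSwinnertonDyer.Theorems.FullDescentOrdinaryNine

open _root_.WeierstrassCurve Literature.NumberTheory.EllipticCurves
  Literature.NumberTheory.GaloisRepresentations Field IsDedekindDomain.HeightOneSpectrum

/-! ## §3 The two kernels at a good ordinary place -/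

/-- **The ordinary kernels `Λ = ker f ⊓ E[p]` and `K₂ = ker f ⊓ E[p²]` at a good ordinary place.**
Let `W/K` be an elliptic curve over a number field, `p` a prime, `v ∣ p` a finite place of good
ORDINARY reduction (`p ∤ a_v`), and suppose some `τ ∈ I_{K_v}` has `χ̄_p(res τ) ≠ 1` (true whenever
`e(v|p) < p − 1`). Then there are subgroups `Λ ≤ E[p]`, `K₂ ≤ E[p²]` of `E(K̄)` (the kernels of the
reduction map `f : E(K̄) → Ẽ_v(k̄_v)` of `exists_goodReductionHom_frobenius` on `E[p]`, `E[p²]`) with: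
`#Λ = p`, `#K₂ = p²`, `K₂ ⊓ E[p] = Λ`; `Λ` and `K₂` stable under `res : Γ_{K_v} → Γ_K`; for `τ ∈ I_{K_v}`:
`res τ • x − x ∈ Λ` on `E[p]`, `res τ • x − x ∈ K₂` on `E[p²]` (inertia trivial on the quotients),
`res τ • x = χ̄_{p²}(res τ) • x` on `K₂` and `res τ • x = χ̄_p(res τ) • x` on `Λ` (§1); and if EVERY
`σ ∈ Γ_{K_v}` acts trivially on `E[p²]/K₂` then `p² ≤ #Ẽ_v(k_v)` (the `p²` points of `f(E[p²])` are fixed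
by the `q_v`-Frobenius, `f (res σ_v • a) = φ_v • f a`, hence `k_v`-rational). `#K₂ = p²`: otherwise
`K₂ = Λ`, inertia is trivial on `E[p²]/Λ` hence on `p • E[p²] = E[p] ⊇ Λ`, contradicting `χ̄_p(res τ) ≠ 1`
on `Λ`. Serre 1972 §1.11 Prop. 11, Cor. (the lines `X_p ⊂ X_{p²} ⊂ …`, inertia through `χ` on the kernel and
trivially on `Ẽ`); Greenberg LNM 1716 §2.
[cite: SerreInventiones1972, §1.11 Prop. 11 and Cor.] [cite: GreenbergLNM1716, §2 pp. 62–63]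
[cite: SilvermanAEC2009, Prop. VII.2.1, VII.3.1, proof of Thm. V.1.1] -/
theorem exists_ordinary_reduction_kernels {K : Type} [Field K] [NumberField K]
    (W : WeierstrassCurve K) [W.IsElliptic] (p : ℕ) [hp : Fact p.Prime]
    (v : HeightOneSpectrum (𝓞 K)) (hpv : (p : 𝓞 K) ∈ v.asIdeal) (hgood : W.HasGoodReductionAt v)
    (hord : ¬ ((p : ℤ) ∣ W.frobeniusTraceAt v))
    (hτ : ∃ τ ∈ absInertia (v.adicCompletion K),
      modNCyclotomicCharacter K p (absGaloisRestrict K (v.adicCompletion K) τ) ≠ 1) :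
    ∃ Λ K₂ : AddSubgroup (geomPoints W),
      Λ ≤ geomTorsion W p ∧ Nat.card Λ = p ∧
      K₂ ≤ geomTorsion W (p ^ 2 : ℕ) ∧ Nat.card K₂ = p ^ 2 ∧ K₂ ⊓ geomTorsion W p = Λ ∧
      (∀ (τ : absoluteGaloisGroup (v.adicCompletion K)), ∀ x ∈ Λ,
        absGaloisRestrict K (v.adicCompletion K) τ • x ∈ Λ) ∧
      (∀ (τ : absoluteGaloisGroup (v.adicCompletion K)), ∀ x ∈ K₂,
        absGaloisRestrict K (v.adicCompletion K) τ • x ∈ K₂) ∧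
      (∀ τ ∈ absInertia (v.adicCompletion K), ∀ x ∈ geomTorsion W p,
        absGaloisRestrict K (v.adicCompletion K) τ • x - x ∈ Λ) ∧
      (∀ τ ∈ absInertia (v.adicCompletion K), ∀ x ∈ geomTorsion W (p ^ 2 : ℕ),
        absGaloisRestrict K (v.adicCompletion K) τ • x - x ∈ K₂) ∧
      (∀ τ ∈ absInertia (v.adicCompletion K), ∀ x ∈ K₂,
        absGaloisRestrict K (v.adicCompletion K) τ • x =
          ((modNCyclotomicCharacter K (p ^ 2) (absGaloisRestrict K (v.adicCompletion K) τ) :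
            (ZMod (p ^ 2))ˣ) : ZMod (p ^ 2)).val • x) ∧
      (∀ τ ∈ absInertia (v.adicCompletion K), ∀ x ∈ Λ,
        absGaloisRestrict K (v.adicCompletion K) τ • x =
          ((modNCyclotomicCharacter K p (absGaloisRestrict K (v.adicCompletion K) τ) :
            (ZMod p)ˣ) : ZMod p).val • x) ∧
      ((∀ (σ : absoluteGaloisGroup (v.adicCompletion K)), ∀ x ∈ geomTorsion W (p ^ 2 : ℕ),
          absGaloisRestrict K (v.adicCompletion K) σ • x - x ∈ K₂) →
        p ^ 2 ≤ Nat.card (W.reductionAt v).toAffine.Point) := by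
  have hpp : p.Prime := hp.out
  -- Frobenius data at `v` and the reduction map
  obtain ⟨𝔐, h𝔐⟩ := v.localPrimesAbove_nonempty
  obtain ⟨σF, hσF⟩ := v.exists_isArithFrobAt_localAbsIntegers h𝔐
  haveI : Finite (IsLocalRing.ResidueField (v.adicCompletionIntegers K)) :=
    finite_residueField_adicCompletionIntegers K v
  obtain ⟨φ, hφ⟩ := exists_frobenius_absoluteGaloisGroup
    (IsLocalRing.ResidueField (v.adicCompletionIntegers K))
  obtain ⟨f, hS, hI, hF, hKcard⟩ :=
    exists_goodReductionHom_frobenius W p v hpv hgood hord h𝔐 hσF hφ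
  -- notation
  set res := absGaloisRestrict K (v.adicCompletion K) with hres
  set Λ : AddSubgroup (geomPoints W) := f.ker ⊓ geomTorsion W p with hΛ
  set K₂ : AddSubgroup (geomPoints W) := f.ker ⊓ geomTorsion W (p ^ 2 : ℕ) with hK₂
  -- torsion is preserved by the Galois action
  have htors : ∀ (n : ℕ) (g : absoluteGaloisGroup K), ∀ x ∈ geomTorsion W n,
      g • x ∈ geomTorsion W n := by
    intro n g x hx
    rw [mem_torsionBy_iff] at hx ⊢
    rw [smul_comm, hx, smul_zero]
  -- stability under the decomposition group
  have hstab : ∀ (n : ℕ) (τ : absoluteGaloisGroup (v.adicCompletion K)),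
      ∀ x ∈ f.ker ⊓ geomTorsion W n, res τ • x ∈ f.ker ⊓ geomTorsion W n := by
    intro n τ x hx
    obtain ⟨h1, h2⟩ := AddSubgroup.mem_inf.mp hx
    exact AddSubgroup.mem_inf.mpr ⟨hS τ x h1, htors n _ x h2⟩
  -- inertia acts trivially modulo the kernels
  have hinert : ∀ (n : ℕ), ∀ τ ∈ absInertia (v.adicCompletion K), ∀ x ∈ geomTorsion W n,
      res τ • x - x ∈ f.ker ⊓ geomTorsion W n := by
    intro n τ hτ x hx
    refine AddSubgroup.mem_inf.mpr ⟨?_, sub_mem (htors n _ x hx) hx⟩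
    rw [AddMonoidHom.mem_ker, map_sub, hI τ hτ x, sub_self]
  have hΛle : Λ ≤ geomTorsion W p := inf_le_right
  have hK₂le : K₂ ≤ geomTorsion W (p ^ 2 : ℕ) := inf_le_right
  have hinf : K₂ ⊓ geomTorsion W p = Λ := ker_inf_torsionBy_sq_inf f p
  -- `Λ` is cyclic: a non-zero element has order `p = #Λ`
  haveI : Finite Λ := Nat.finite_of_card_ne_zero (by rw [hKcard]; exact hpp.ne_zero)
  obtain ⟨x₁, hx₁Λ, hx₁0⟩ : ∃ x₁ ∈ Λ, x₁ ≠ 0 := by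
    by_contra h
    simp only [not_exists, not_and, not_not] at h
    have hbot : Λ = ⊥ := (AddSubgroup.eq_bot_iff_forall _).mpr h
    have h1 : Nat.card Λ = 1 := by rw [hbot]; exact AddSubgroup.card_bot
    rw [hKcard] at h1
    exact hpp.one_lt.ne' h1
  have hx₁ord : addOrderOf x₁ = p := by
    refine addOrderOf_eq_prime ?_ hx₁0
    rw [← natCast_zsmul]
    exact mem_torsionBy_iff.mp (hΛle hx₁Λ)
  have hcycΛ : ∃ y ∈ geomTorsion W p, ∀ x ∈ Λ, ∃ k : ℕ, x = k • y :=
    ⟨x₁, hΛle hx₁Λ, forall_mem_exists_nsmul_eq hpp.pos hKcard hx₁Λ hx₁ord⟩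
  -- inertia acts on `Λ` through `χ̄_p`
  have hχΛ : ∀ τ ∈ absInertia (v.adicCompletion K), ∀ x ∈ Λ,
      res τ • x = ((modNCyclotomicCharacter K p (res τ) : (ZMod p)ˣ) : ZMod p).val • x :=
    fun τ hτI ↦ smul_eq_modNCyclotomicCharacter_smul_of_cyclic W p hpp.two_le hΛle hcycΛ (res τ)
      (hstab p τ) (hinert p τ hτI)
  -- `#K₂ = p²`
  have hK₂card : Nat.card K₂ = p ^ 2 := by
    rcases eq_or_natCard_eq_sq f p hpp hKcard with heq | hcard
    · exfalso
      obtain ⟨τ, hτI, hτχ⟩ := hτ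
      -- inertia would act trivially on `E[p] = p • E[p²]`
      have htriv : res τ • x₁ = x₁ := by
        obtain ⟨y, hy⟩ := zsmul_geomPoints_surjective_holds W
          (n := (p : ℤ)) (by exact_mod_cast hpp.ne_zero) x₁
        change (p : ℤ) • y = x₁ at hy
        have hyT : y ∈ geomTorsion W (p ^ 2 : ℕ) := by
          rw [mem_torsionBy_iff, Nat.cast_pow, pow_two, mul_smul, hy, ← mem_torsionBy_iff]
          exact hΛle hx₁Λ
        have hd : res τ • y - y ∈ Λ := by
          have h := hinert (p ^ 2) τ hτI y hyT
          change res τ • y - y ∈ K₂ at h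
          rw [hK₂, heq] at h
          exact h
        have hd' : (p : ℤ) • (res τ • y - y) = 0 := mem_torsionBy_iff.mp (hΛle hd)
        rw [smul_sub, smul_comm, hy, sub_eq_zero] at hd'
        exact hd'
      have hc := hχΛ τ hτI x₁ hx₁Λ
      rw [htriv] at hc
      set c : ℕ := ((modNCyclotomicCharacter K p (res τ) : (ZMod p)ˣ) : ZMod p).val with hcdef
      have hz : ((c : ℤ) - 1) • x₁ = 0 := by
        rw [sub_zsmul, one_zsmul, natCast_zsmul, ← hc]
        simp
      have hdvd : ((addOrderOf x₁ : ℕ) : ℤ) ∣ (c : ℤ) - 1 :=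
        (addOrderOf_dvd_iff_zsmul_eq_zero).mpr hz
      rw [hx₁ord] at hdvd
      have h1 : ((c : ℤ) : ZMod p) - 1 = 0 := by
        have := (ZMod.intCast_zmod_eq_zero_iff_dvd ((c : ℤ) - 1) p).mpr hdvd
        push_cast at this ⊢
        exact this
      apply hτχ
      ext
      rw [Units.val_one, ← ZMod.natCast_zmod_val
        ((modNCyclotomicCharacter K p (res τ) : (ZMod p)ˣ) : ZMod p), ← hcdef]
      have h2 : ((c : ℤ) : ZMod p) = (c : ZMod p) := Int.cast_natCast c
      rw [← h2]
      exact sub_eq_zero.mp h1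
    · exact hcard
  -- `K₂` is cyclic: an element of `K₂ ∖ Λ` has order `p²`
  have hΛK₂ : Λ ≤ K₂ := ker_inf_torsionBy_le_sq f p
  have hne : Λ ≠ K₂ := by
    intro h
    have h1 : Nat.card Λ = Nat.card K₂ := by rw [h]
    rw [hKcard, hK₂card, pow_two] at h1
    exact hpp.one_lt.ne' ((Nat.mul_eq_left hpp.ne_zero).mp h1.symm)
  obtain ⟨x₂, hx₂K, hx₂Λ⟩ := SetLike.exists_of_lt (lt_of_le_of_ne hΛK₂ hne)
  have hx₂ord : addOrderOf x₂ = p ^ 2 := by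
    have h := addOrderOf_eq_prime_pow (p := p) (n := 1) (x := x₂) ?_ ?_
    · simpa using h
    · intro h0
      rw [pow_one] at h0
      apply hx₂Λ
      rw [← hinf]
      exact AddSubgroup.mem_inf.mpr ⟨hx₂K, mem_torsionBy_iff.mpr (by rw [natCast_zsmul]; exact h0)⟩
    · have := mem_torsionBy_iff.mp (hK₂le hx₂K)
      rwa [natCast_zsmul] at this
  have hcycK₂ : ∃ y ∈ geomTorsion W (p ^ 2 : ℕ), ∀ x ∈ K₂, ∃ k : ℕ, x = k • y :=
    ⟨x₂, hK₂le hx₂K, forall_mem_exists_nsmul_eq (pow_pos hpp.pos 2) hK₂card hx₂K hx₂ord⟩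
  have hχK₂ : ∀ τ ∈ absInertia (v.adicCompletion K), ∀ x ∈ K₂,
      res τ • x = ((modNCyclotomicCharacter K (p ^ 2) (res τ) :
        (ZMod (p ^ 2))ˣ) : ZMod (p ^ 2)).val • x :=
    fun τ hτI ↦ smul_eq_modNCyclotomicCharacter_smul_of_cyclic W (p ^ 2)
      (le_trans hpp.two_le (Nat.le_self_pow two_ne_zero p)) hK₂le hcycK₂ (res τ)
      (hstab (p ^ 2) τ) (hinert (p ^ 2) τ hτI)
  refine ⟨Λ, K₂, hΛle, hKcard, hK₂le, hK₂card, hinf, hstab p, hstab (p ^ 2), hinert p,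
    hinert (p ^ 2), hχK₂, hχΛ, fun hD ↦ ?_⟩
  -- Frobenius cannot act trivially on `E[p²]/K₂`
  haveI := isElliptic_reductionAt hgood
  have hfix : ∀ P ∈ (geomTorsion W (p ^ 2 : ℕ)).map f, φ • P = P := by
    rintro _ ⟨x, hx, rfl⟩
    have h1 : f (res σF • x - x) = 0 := (AddSubgroup.mem_inf.mp (hD σF x hx)).1
    rw [map_sub, sub_eq_zero, hres, hF x] at h1
    exact h1
  have hrat : ∀ P ∈ (geomTorsion W (p ^ 2 : ℕ)).map f,
      P ∈ Set.range (W.reductionAt v).toGeomPoints := fun P hP ↦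
    mem_range_toGeomPoints_of_smul_eq hφ (hfix P hP)
  haveI : Finite (WithZero {xy : IsLocalRing.ResidueField (v.adicCompletionIntegers K) ×
      IsLocalRing.ResidueField (v.adicCompletionIntegers K) //
        (W.reductionAt v).toAffine.Nonsingular xy.1 xy.2}) := inferInstanceAs (Finite (Option _))
  haveI : Finite (W.reductionAt v).toAffine.Point :=
    Finite.of_equiv _ (Affine.nonsingularPointEquiv (W.reductionAt v).toAffine).symm
  choose g hg using hrat
  have hginj : Function.Injective (fun P : (geomTorsion W (p ^ 2 : ℕ)).map f ↦ g P.1 P.2) := by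
    intro P Q hPQ
    apply Subtype.ext
    rw [← hg P.1 P.2, ← hg Q.1 Q.2]
    exact congrArg _ hPQ
  have hle := Nat.card_le_card_of_injective _ hginj
  -- `#f(E[p²]) = p²`
  have hE : Nat.card (geomTorsion W (p ^ 2 : ℕ)) = (p ^ 2) ^ 2 :=
    card_torsionBy_eq_sq (E := W.baseChange (AlgebraicClosure K)) (n := p ^ 2)
      (by exact_mod_cast pow_ne_zero 2 hpp.ne_zero)
  have hmul := natCard_torsionBy_eq_mul f (p ^ 2)
  change Nat.card (geomTorsion W (p ^ 2 : ℕ)) = Nat.card K₂ * _ at hmul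
  rw [hE, hK₂card, pow_two (p ^ 2)] at hmul
  have hmap : Nat.card ((geomTorsion W (p ^ 2 : ℕ)).map f) = p ^ 2 :=
    (Nat.eq_of_mul_eq_mul_left (pow_pos hpp.pos 2) hmul.symm)
  rw [hmap] at hle
  exact hle

end Summit.BirchSwinnertonDyer.BirchSwinnertonDyer.Theorems.FullDescentOrdinaryNine

end
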